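import Summits.BirchSwinnertonDyer.Rank1Residual.X11b.CoinvariantsDescent
import Literature.NumberTheory.GaloisRepresentations.HochschildSerreLowDegree
import HarnessLib

/-!
# `(conj_γ − 1)`-divisibility of `H¹(K_∞, E[p^∞])` from the VANISHING OF ONE OBSTRUCTION CLASS in
# `H²(Γ_K, E[p^∞])` that restricts to `0` on `Gal(K̄/K_∞)` — the procyclic-descent engine without `H² = 0`

Route `ThetaPartnerAtTwo` (TP2; crux shared with `ResidualThetaTransportAtTwo`), crux K4 `SignedControlAtTwo`
(stmt-BirchSwinnertonDyer-20309), line `eulerchar` v10. Seat `prover-bsd-wall-tp2-p3-w2` (width seat 2/3, gen 5),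
lane «Prop. 4.12 elimination (habitat road)». Part 1.

WHY. K4's registered residue is `{Cassels, Greenberg Prop. 4.12, PT(ℚ)}`. Prop. 4.12
(`Greenberg1999.prop412_noFiniteSubmodule_H1Sigma_of_rank_one`, «`H¹(ℚ_Σ/ℚ_∞, E[2^∞])` has no proper
`Λ`-submodule of finite index») enters K4 ONLY through COINV: «every class of `Sel⁺(E/ℚ_∞)` is
`conj_γ t − t` for a class `t` of an ambient group» (`SignedEC.signedEndCoinvariants_subsingleton_of_ambient`,
hypothesis `hdiv`). The X11b sub-cell's procyclic descent (`X11b.ProcyclicDescent`, JSW17 Lemma 3.3.3 on Serre's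
`M_G^H(A)`) proves `H¹(K_∞, E[p^∞]) = (conj_γ − 1) H¹(K_∞, E[p^∞])` from `H²(Γ_K, E[p^∞]) = 0` — true for
totally complex `K`, FALSE in general for `K = ℚ`, `p = 2` (`H²(ℝ, E[2^∞]) ≅ ℤ/2` when `Δ_E > 0`). This file
removes the hypothesis `H² = 0`: the obstruction to dividing a class `x` by `conj_γ − 1` is ONE class
`c(x) = δ₁(sh⁻¹ x) ∈ H²(Γ_K, E[p^∞])`, and `c(x)` RESTRICTS TO ZERO on `H = Gal(K̄/K_∞)` (the unit
`A → M_G^H(A)` is split over `H` by "valeur au point `1`", so the connecting map of the restricted sequence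
vanishes). Hence it suffices that `res_H : H²(Γ_K, E[p^∞]) → H²(H, E[p^∞])` be injective — over `ℚ` at `p = 2`
this follows from `H²(ℚ_v, E[2^∞]) = 0` (finite `v`), `Ш²(ℚ, E[2^∞]) = 0` (finite-level Poitou–Tate) and the real
place lying BELOW `ℚ_∞` (parts 2–4 of the lane). Equivalently: the Hochschild–Serre edge
`H¹(Γ, H¹(H, A)) ↪ ker(H²(G, A) → H²(H, A))` (`E₂^{2,0} = 0` here because `A^H`-cohomology of `Γ ≅ ℤ_p`
in degree `2` is not needed on this road).

WHAT IS PROVED (namespace `…Theorems.SignedEC.HOneCoinv`; `G` profinite, `κ : G ↠ ℤ_p`, `H = ker κ`, `κ(γ) = 1`,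
`A` a `p`-primary discrete `G`-module with open stabilisers):
* §1 `resSubgroup_two_δ₁_eq_zero` — for the short exact sequence `0 → A → M_G^H(A) →(S_γ − 1) M_G^H(A) → 0`
  (`isSES_unit_tHom`), `res_H (δ₁ z) = 0` for every `z ∈ H¹(G, M_G^H(A))`.
* §2 `exists_obstruction` — for every `x ∈ H¹(H, A)` there is `c ∈ H²(G, A)` with `res_H c = 0` and
  `c = 0 → ∃ y, conj_γ y − y = x`; `exists_conjH1_sub_eq_of_resSubgroup_two_injective` — if `res_H` is
  injective on `H²(G, A)` then `conj_γ − 1` is ONTO `H¹(H, A)`.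
* §3 the same for `G = Γ_K`, `A = E[p^∞]` (`W.subgroupH1 p κ.kerSubgroup`, `W.conjH1`, `primaryGaloisModule W p`):
  `exists_conjH1_sub_eq_of_resKer_two_injective`.

HONEST FRAMING: THEOREMS ONLY (no definition, no named fact, no `sorry`); a refinement of the X11b engine
(credit: sub-cell b2b-bsdres-multr1-p1, `ProcyclicDescent` / `CoinvariantsDescent`), route-independent; nothing
about any curve is asserted; closes no item by itself; BSD is not proved by any of this.

References: [JetchevSkinnerWan2017] Lemma 3.3.3 (arXiv:1512.06894 pp. 11–12); [SerreGaloisCohomology1997]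
I §2.5 Prop. 10, I §2.6 (b); [NeukirchSchmidtWingberg2008] (2.4.1) (Hochschild–Serre, low degrees);
[GreenbergLNM1716] §4 Prop. 4.12 and p. 119 (the statement this road replaces).
-/

set_option autoImplicit false
-- the Theorems namespace of this sub repeats the summit name by design (D-0017 nested layout)
set_option linter.dupNamespace false

noncomputable section

open CategoryTheory Function
open Literature.NumberTheory.GaloisRepresentations Literature.NumberTheory.EllipticCurves

universe u

namespace Summit.BirchSwinnertonDyer.BirchSwinnertonDyer.Theorems.SignedEC.HOneCoinv

open Summit.BirchSwinnertonDyer.Rank1Residual.X11b.ProcyclicDescent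

/-! ## §1 The connecting map of `0 → A → M_G^H(A) → M_G^H(A) → 0` dies after restriction to `H` -/

section Generic

variable {G : Type u} [Group G] [TopologicalSpace G] [IsTopologicalGroup G] [CompactSpace G]
  [T2Space G] [TotallyDisconnectedSpace G]
variable {A : Type u} [AddCommGroup A] [DistribMulAction G A] [TopologicalSpace A] [DiscreteTopology A]
variable (hA : ∀ a : A, IsOpen {g : G | g • a = a})
variable {p : ℕ} [Fact p.Prime] (κ : G →ₜ* Multiplicative ℤ_[p]) (hκ : Surjective κ)
  (γ : G) (hγ : κ γ = Multiplicative.ofAdd 1) (hAt : IsPrimaryTorsion p A)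

omit [T2Space G] [TotallyDisconnectedSpace G] in
/-- **"Valeur au point `1`" splits the unit over `H`**: for every subgroup `H ≤ G` there is a morphism of
topological `H`-modules `r : M_G^H(A)|_H → A|_H` with `r (unit a) = a` (Serre I §2.5: `a* ↦ a*(1)` is
`H`-equivariant, and `(unit a)(1) = 1 • a = a`). [cite: SerreGaloisCohomology1997, I §2.5 Prop. 10] -/
theorem exists_retraction_unitHom (H : Subgroup G) :
    ∃ r : ((coindRep (subRep hA H)).restrict (Literature.NumberTheory.GaloisRepresentations.subgroupIncl H)).toTopRep ⟶
        ((discreteRep hA).restrict (Literature.NumberTheory.GaloisRepresentations.subgroupIncl H)).toTopRep,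
      ∀ f : coindModule (subRep hA H), r.hom f = (f : C(G, A)) 1 := by
  refine ⟨TopRep.ofHom
    { toLinearMap :=
        { toFun := fun f => (f : C(G, A)) 1
          map_add' := fun _ _ => rfl
          map_smul' := fun _ _ => rfl }
      cont := (continuous_eval_const (1 : G)).comp continuous_subtype_val
      isIntertwining' := fun s => ?_ }, fun _ => rfl⟩
  ext f
  change ((coindRep (subRep hA H) (s : G) f : coindModule (subRep hA H)) : C(G, A)) 1 =
    (s : G) • ((f : coindModule (subRep hA H)) : C(G, A)) 1
  rw [coindRep_apply_apply, one_mul, ← mul_one (s : G), coind_apply_mul, mul_one]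

omit [TotallyDisconnectedSpace G] in
include hκ hγ hAt in
/-- **`res_H (δ₁ z) = 0`** for the connecting map `δ₁ : H¹(G, M_G^H(A)) → H²(G, A)` of
`0 → A →(unit) M_G^H(A) →(S_γ − 1) M_G^H(A) → 0` (`H = ker κ`): restriction commutes with `δ₁`
(`resSubgroup_δ₁`), and over `H` the unit has the retraction `r` of `exists_retraction_unitHom`, so
`δ₁^H = H²(r) ∘ H²(unit|_H) ∘ δ₁^H = H²(r) ∘ 0 = 0`. (This is `E₂^{1,1} → H²(G, A)` landing in
`ker(H²(G, A) → H²(H, A))`, Hochschild–Serre.) [cite: NeukirchSchmidtWingberg2008, (2.4.1)]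
[cite: SerreGaloisCohomology1997, I §2.5 Prop. 10] -/
theorem resSubgroup_two_δ₁_eq_zero
    (z : continuousCohomology 1 (coindRep (subRep hA (kerK κ))).toTopRep) :
    resSubgroup (discreteRep hA).toTopRep (kerK κ) 2 ((isSES_unit_tHom hA κ hκ hγ hAt).δ₁ z) = 0 := by
  haveI : CompactSpace (kerK κ) := isCompact_iff_compactSpace.mp (isClosed_kerK κ).isCompact
  have h := isSES_unit_tHom hA κ hκ hγ hAt
  have hN : IsSES (restrictHom (kerK κ) (unitHom hA (kerK κ))) (restrictHom (kerK κ) (tHom hA (kerK κ) γ)) :=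
    h.restrictN (N := kerK κ)
  rw [resSubgroup_δ₁ (kerK κ) h hN z]
  -- `δ₁^H w = 0` for every `w`
  set w := resSubgroup (coindRep (subRep hA (kerK κ))).toTopRep (kerK κ) 1 z with hw
  obtain ⟨c, hc⟩ := twoCocycleClass_surjective _ (hN.δ₁ w)
  have h0 : cohomologyMap (restrictHom (kerK κ) (unitHom hA (kerK κ))) 2 (hN.δ₁ w) = 0 := hN.map_two_δ₁ w
  obtain ⟨r, hr⟩ := exists_retraction_unitHom hA (kerK κ)
  have h1 := congrArg (cohomologyMap r 2) h0
  rw [map_zero, ← hc, cohomologyMap_twoCocycleClass, cohomologyMap_twoCocycleClass] at h1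
  have key : contTwoCocycles.pullback (ContinuousMonoidHom.id _) (resIdHom r)
      (contTwoCocycles.pullback (ContinuousMonoidHom.id _) (resIdHom (restrictHom (kerK κ) (unitHom hA (kerK κ)))) c) =
      c := by
    refine Subtype.ext (ContinuousMap.ext fun q => ?_)
    obtain ⟨σ, τ⟩ := q
    rw [contTwoCocycles.pullback_apply, contTwoCocycles.pullback_apply, resIdHom_hom_apply, resIdHom_hom_apply,
      hr, restrictHom_hom_apply, unitHom_apply, unitFun_apply, one_smul]
    rfl
  rw [key] at h1
  rw [← hc]
  exact h1

/-! ## §2 The obstruction class and the descent theorem -/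

include hκ hγ hAt in
/-- **The obstruction class.** For every `x ∈ H¹(H, A)` (`H = ker κ`) there is `c ∈ H²(G, A)` — namely
`δ₁(sh⁻¹ x)` for the Shapiro isomorphism `sh : H¹(G, M_G^H(A)) ⥲ H¹(H, A)` — with `res_H c = 0` (§1) and such
that `c = 0` forces `x = conj_γ y − y` for some `y ∈ H¹(H, A)` (exactness at `H¹(G, M_G^H(A))` and
`sh ∘ H¹(S_γ − 1) = (conj_{γ⁻¹} − 1) ∘ sh`, verbatim as in X11b's `exists_conjH1_sub_eq_of_subsingleton`).
[cite: JetchevSkinnerWan2017, Lemma 3.3.3 (arXiv:1512.06894 pp. 11–12)] [cite: SerreGaloisCohomology1997, I §2.5 Prop. 10] -/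
theorem exists_obstruction (x : subgroupH1 (kerK κ) A) :
    ∃ c : continuousCohomology 2 (discreteRep hA).toTopRep,
      resSubgroup (discreteRep hA).toTopRep (kerK κ) 2 c = 0 ∧
      (c = 0 → ∃ y : subgroupH1 (kerK κ) A, conjH1 (kerK κ) A γ y - y = x) := by
  obtain ⟨z, rfl⟩ := sh_surjective hA (kerK κ) (isClosed_kerK κ) x
  refine ⟨(isSES_unit_tHom hA κ hκ hγ hAt).δ₁ z, resSubgroup_two_δ₁_eq_zero hA κ hκ γ hγ hAt z,
    fun hδ => ?_⟩
  obtain ⟨z', rfl⟩ := (isSES_unit_tHom hA κ hκ hγ hAt).exists_map_one_eq_of_δ₁_eq_zero z hδ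
  refine ⟨-(conjH1 (kerK κ) A γ⁻¹ (sh hA (kerK κ) z')), ?_⟩
  rw [sh_cohomologyMap_tHom, map_neg, ← AddMonoidHom.comp_apply, ← conjH1_mul_holds (kerK κ) A γ γ⁻¹,
    mul_inv_cancel, conjH1_one_holds (kerK κ) A, AddMonoidHom.id_apply]
  abel

include hκ hγ hAt in
/-- **Trivial coinvariants from the injectivity of `res_H` on `H²`**: if every class of `H²(G, A)` that
restricts to `0` on `H = ker κ` is `0`, then `H¹(H, A) = (conj_γ − 1) H¹(H, A)` — the hypothesis `H²(G, A) = 0`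
of X11b's `exists_conjH1_sub_eq_of_subsingleton` weakened to what the obstruction of `exists_obstruction`
needs. [cite: JetchevSkinnerWan2017, Lemma 3.3.3 (arXiv:1512.06894 pp. 11–12)]
[cite: NeukirchSchmidtWingberg2008, (2.4.1)] -/
theorem exists_conjH1_sub_eq_of_resSubgroup_two_injective
    (hinj : ∀ c : continuousCohomology 2 (discreteRep hA).toTopRep,
      resSubgroup (discreteRep hA).toTopRep (kerK κ) 2 c = 0 → c = 0)
    (x : subgroupH1 (kerK κ) A) :
    ∃ y : subgroupH1 (kerK κ) A, conjH1 (kerK κ) A γ y - y = x := by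
  obtain ⟨c, hc, h⟩ := exists_obstruction hA κ hκ γ hγ hAt x
  exact h (hinj c hc)

include hκ hγ hAt in
/-- The special case `H²(G, A) = 0` (X11b's theorem, recovered). [cite: JetchevSkinnerWan2017, Lemma 3.3.3 (arXiv:1512.06894 pp. 11–12)] -/
theorem exists_conjH1_sub_eq_of_subsingleton_two
    [Subsingleton (continuousCohomology 2 (discreteRep hA).toTopRep)] (x : subgroupH1 (kerK κ) A) :
    ∃ y : subgroupH1 (kerK κ) A, conjH1 (kerK κ) A γ y - y = x :=
  exists_conjH1_sub_eq_of_resSubgroup_two_injective hA κ hκ γ hγ hAt (fun c _ => Subsingleton.elim c 0) x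

end Generic

/-! ## §3 Elliptic curves: `H¹(K_∞, E[p^∞]) = (conj_γ − 1) H¹(K_∞, E[p^∞])` from `res : H²(K, E[p^∞]) ↪ H²(K_∞, E[p^∞])` -/

section EC

open Field NumberField

variable {K : Type} [Field K] [NumberField K] (W : WeierstrassCurve K) (p : ℕ) [Fact p.Prime]
  (κ : ZpExtension K p)

open Summit.BirchSwinnertonDyer.Rank1Residual.X11b.Coinv (isPrimaryTorsion_geomPrimaryTorsion)
open Summit.BirchSwinnertonDyer.Rank1Residual.X11b.LocBridge (primaryGaloisModule isOpen_stabilizer_geomPrimaryTorsion)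

omit [NumberField K] in
/-- **`conj_γ − 1` is ONTO `H¹(K_∞, E[p^∞])` as soon as `res : H²(Γ_K, E[p^∞]) → H²(Gal(K̄/K_∞), E[p^∞])`
is injective** (`κ` a `ℤ_p`-extension with kernel `Gal(K̄/K_∞)`, `γ` a topological generator). For `K` totally
complex `H²(Γ_K, E[p^∞]) = 0` (X11b `WeakLeopoldt`); for `K = ℚ`, `p = 2` the injectivity is parts 2–4 of this
lane. This is the `hdiv` input of `SignedEC.signedEndCoinvariants_subsingleton_of_ambient` with the ambient group
ALL of `H¹(ℚ_∞, E[2^∞])` — NO Prop. 4.12, NO corank count, NO dual datum.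
[cite: JetchevSkinnerWan2017, Lemma 3.3.3 (arXiv:1512.06894 pp. 11–12)] [cite: GreenbergLNM1716, §4 p. 119] -/
theorem exists_conjH1_sub_eq_of_resKer_two_injective
    (hinj : ∀ c : galoisCohomology (primaryGaloisModule W p) 2,
      resSubgroup (primaryGaloisModule W p).toTopRep κ.kerSubgroup 2 c = 0 → c = 0)
    {γ : absoluteGaloisGroup K} (hγ : κ.IsTopGenerator γ) (x : W.subgroupH1 p κ.kerSubgroup) :
    ∃ y : W.subgroupH1 p κ.kerSubgroup, W.conjH1 p κ.kerSubgroup γ y - y = x := by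
  haveI : CompactSpace (absoluteGaloisGroup K) := absoluteGaloisGroup_compactSpace K
  exact exists_conjH1_sub_eq_of_resSubgroup_two_injective
    (isOpen_stabilizer_geomPrimaryTorsion W p) κ.toContinuousMonoidHom κ.surjective γ hγ
    (isPrimaryTorsion_geomPrimaryTorsion W p) hinj x

end EC

end Summit.BirchSwinnertonDyer.BirchSwinnertonDyer.Theorems.SignedEC.HOneCoinv

end
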